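import Literature.Computability.Complexity.AdaptiveBPPSimulation

set_option linter.dupNamespace false

/-!
# Stub S2 of line `SketchIdeator1` (crux stmt-PneNP-2717): the pseudo-deterministic simulation of an
adaptive reduction to a `BPP` language fails on at most `1/8` of the coin strings

`AdBPPSim.exists_accF_good` (Arora–Barak 2009, §7.4.1 with Thm. 7.10) re-run with the stronger error
reduction `BPP_subset_bpErr_two_pow 2` (error `≤ 2^{-|w|²}` instead of `2^{-|w|}`): a coin string `r`
of length `T` for which the simulated answer string `accF B t Qg q ⟨x, r⟩` differs from the true one
`adBits Qg A x (q|x|)` errs on some string `s` of length `≤ c` (a bound on the queries), an event of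
probability `≤ 2^{-(2|s|+3)²} ≤ 2^{-(2|s|+4)}`, and `Σ_{ℓ ≤ c} 2^ℓ · 2^{-(2ℓ+4)} = (1/16) Σ_ℓ 2^{-ℓ} ≤ 1/8`.
-/

namespace Summit.PneNP.PneNP.Theorems.NoFBPPApproxAboveUniqueness

open Literature.Computability.Complexity _root_.Computability Polynomial Brick Plumb AdQuery AdBPPSim Finset

/-- `2^j · (1/2)^{2j+4} = (1/16) · (1/2)^j`. [folklore] -/
private theorem two_pow_mul_half_pow (j : ℕ) :
    (2 : ℝ) ^ j * (1 / 2) ^ (2 * j + 4) = 1 / 16 * (1 / 2) ^ j := by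
  have h1 : (2 : ℝ) ^ j * (1 / 2) ^ j = 1 := by
    rw [← mul_pow]; norm_num
  calc (2 : ℝ) ^ j * (1 / 2) ^ (2 * j + 4)
      = ((2 : ℝ) ^ j * (1 / 2) ^ j) * ((1 / 2) ^ j * (1 / 2) ^ 4) := by ring
    _ = 1 / 16 * (1 / 2) ^ j := by rw [h1, one_mul, mul_comm]; norm_num

/-- **The union bound at error `2^{-|w|²}`.** Let `B ∈ P`, `t` decide the padded language
`{⟨s,1⟩ | s ∈ A}` with error `≤ 2^{-|w|²}` on every `w`, let all queries on `x` (against `A`) have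
length `≤ c`, and let `T ≥ t(2c + 3)`. Then the coin strings of length `T` on which the simulated
answer string differs from the true one have probability `≤ 1/8`: such a string errs on some `s` with
`|s| ≤ c`, an event of probability `≤ 2^{-(2|s|+3)²} ≤ 2^{-(2|s|+4)}` (prefix coins), and
`Σ_{ℓ ≤ c} 2^ℓ 2^{-(2ℓ+4)} ≤ 1/8`. [cite: AroraBarak2009, §7.4.1 (union bound) with Thm. 7.10] -/
private theorem uniformProb_accF_ne_le_sq {B : Language Bool} {t : Polynomial ℕ}
    {Qg : List Bool → List Bool} {q : Polynomial ℕ} {A : Language Bool} {x : List Bool} {c T : ℕ}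
    (hB : ∀ w : List Bool,
      uniformProb (t.eval w.length) {y | ¬ (boolPair w y ∈ B ↔ fstF w ∈ A)} ≤ 1 / 2 ^ (w.length ^ 2))
    (hlen : ∀ k < q.eval x.length, (Qg (boolPair x (adBits Qg A x k))).length ≤ c)
    (hT : t.eval (2 * c + 3) ≤ T) :
    uniformProb T {r | accF B t Qg q (boolPair x r) ≠ adBits Qg A x (q.eval x.length)} ≤ 1 / 8 := by
  -- the bad event of one string `s`
  set Bad : List Bool → Set (List Bool) := fun s => {r | ¬ (s ∈ coinLang B t r ↔ s ∈ A)} with hBad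
  have hBadP : ∀ s : List Bool, s.length ≤ c →
      uniformProb T (Bad s) ≤ (1 / 2 : ℝ) ^ (2 * s.length + 4) := by
    intro s hs
    have hts : t.eval (padQ s).length ≤ T := by
      rw [length_padQ]; exact (TM2Iter.eval_mono t (by omega)).trans hT
    obtain ⟨d, hd⟩ : ∃ d, T = t.eval (padQ s).length + d := ⟨T - t.eval (padQ s).length, by omega⟩
    have hE : uniformProb (t.eval (padQ s).length) {y | ¬ (boolPair (padQ s) y ∈ B ↔ s ∈ A)} ≤
        (1 / 2 : ℝ) ^ (2 * s.length + 4) := by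
      have h := hB (padQ s)
      rw [show fstF (padQ s) = s by simp, length_padQ] at h
      rw [length_padQ]
      refine h.trans ?_
      rw [one_div_pow]
      exact one_div_le_one_div_of_le (by positivity)
        (pow_le_pow_right₀ (by norm_num) (by nlinarith))
    rw [hd]
    exact BPExp.uniformProb_take_le {y | ¬ (boolPair (padQ s) y ∈ B ↔ s ∈ A)} hE
  -- a coin string outside all bad events reproduces the true answer bits
  have hsub : ∀ r ∈ {r : List Bool | accF B t Qg q (boolPair x r) ≠ adBits Qg A x (q.eval x.length)},
      r.length = T → r ∈ ⋃ j ∈ range (c + 1), ⋃ v ∈ (univ : Finset (List.Vector Bool j)), Bad v.toList := by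
    intro r hne _
    by_contra hgood
    simp only [Set.mem_iUnion, mem_range, Finset.mem_univ, exists_true_left, not_exists] at hgood
    apply hne
    rw [accF_apply]
    refine adBits_congr_of_agree (X := coinLang B t r) (Y := A) hlen (fun s hs => ?_) _ le_rfl
    have h := hgood s.length (by omega) ⟨s, rfl⟩
    simpa [hBad] using h
  calc uniformProb T {r | accF B t Qg q (boolPair x r) ≠ adBits Qg A x (q.eval x.length)}
      ≤ uniformProb T (⋃ j ∈ range (c + 1), ⋃ v ∈ (univ : Finset (List.Vector Bool j)), Bad v.toList) :=
        BPExp.uniformProb_mono_len hsub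
    _ ≤ ∑ j ∈ range (c + 1), uniformProb T (⋃ v ∈ (univ : Finset (List.Vector Bool j)), Bad v.toList) :=
        uniformProb_biUnion_le _ _ _
    _ ≤ ∑ j ∈ range (c + 1), ∑ v ∈ (univ : Finset (List.Vector Bool j)), uniformProb T (Bad v.toList) :=
        sum_le_sum fun j _ => uniformProb_biUnion_le _ _ _
    _ ≤ ∑ j ∈ range (c + 1), ∑ v ∈ (univ : Finset (List.Vector Bool j)), (1 / 2 : ℝ) ^ (2 * j + 4) :=
        sum_le_sum fun j hj => sum_le_sum fun v _ => by
          have := hBadP v.toList (by rw [List.Vector.toList_length]; exact Nat.lt_succ_iff.1 (mem_range.1 hj))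
          rwa [List.Vector.toList_length] at this
    _ = ∑ j ∈ range (c + 1), (1 / 16 : ℝ) * (1 / 2) ^ j := by
        refine sum_congr rfl fun j _ => ?_
        rw [sum_const, card_univ, card_vector, Fintype.card_bool, nsmul_eq_mul]
        push_cast
        exact two_pow_mul_half_pow j
    _ = (1 / 16 : ℝ) * ∑ j ∈ range (c + 1), (1 / 2 : ℝ) ^ j := by rw [mul_sum]
    _ ≤ (1 / 16 : ℝ) * 2 := by gcongr; exact sum_half_pow_le_two _
    _ = 1 / 8 := by norm_num

/-- **Stub S2.** For `A ∈ BPP` and `Qg ∈ FP` there are a witness language `B ∈ P`, a coin polynomial `t`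
and a coin budget `T` such that, for every `x`, the simulated answer string `accF B t Qg q ⟨x, r⟩` differs
from `adBits Qg A x (q|x|)` for at most `1/8` of the coin strings `r ∈ {0,1}^{T(|x|)}`
(`AdBPPSim.exists_accF_good` re-run with `BPP_subset_bpErr_two_pow 2`: a coin string is bad only if it errs on
some `s` with `|s| ≤ c`, probability `≤ 2^{-(2|s|+3)²} ≤ 2^{-(2|s|+4)}`, and `Σ_ℓ 2^ℓ 2^{-(2ℓ+4)} ≤ 1/8`).
[cite: AroraBarak2009, §7.4.1 with Thm. 7.10] -/
theorem stub_exists_accF_good_eighth {A : Language Bool} (hA : A ∈ BPP) {Qg : List Bool → List Bool}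
    (hQ : Qg ∈ FP) (q : Polynomial ℕ) :
    ∃ B ∈ Classes.P, ∃ t T : Polynomial ℕ, ∀ x : List Bool,
      uniformProb (T.eval x.length)
        {r | accF B t Qg q (boolPair x r) ≠ adBits Qg A x (q.eval x.length)} ≤ 1 / 8 := by
  -- amplification of the padded language to error `2^{-|w|²}`
  have hA' : (fstF ⁻¹' A : Language Bool) ∈ BPP := preimage_mem_BPP hA fstF_mem_FP
  obtain ⟨B, hB, t, ht⟩ := BPP_subset_bpErr_two_pow 2 hA'
  -- a bound on the queries
  obtain ⟨s, hs⟩ := exists_poly_length_le_of_mem_FP hQ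
  refine ⟨B, hB, t, t.comp (2 * s.comp (2 * X + 2 + q) + 3), fun x => ?_⟩
  set c := s.eval (2 * x.length + 2 + q.eval x.length) with hc
  have hlen : ∀ k < q.eval x.length, (Qg (boolPair x (adBits Qg A x k))).length ≤ c := by
    intro k hk
    refine (hs _).trans (TM2Iter.eval_mono s ?_)
    rw [length_boolPair, length_adBits]; omega
  have hT : (t.comp (2 * s.comp (2 * X + 2 + q) + 3)).eval x.length = t.eval (2 * c + 3) := by
    simp [hc]
  have hB' : ∀ w : List Bool,
      uniformProb (t.eval w.length) {y | ¬ (boolPair w y ∈ B ↔ fstF w ∈ A)} ≤ 1 / 2 ^ (w.length ^ 2) :=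
    fun w => ht w
  rw [hT]
  exact uniformProb_accF_ne_le_sq hB' hlen le_rfl

end Summit.PneNP.PneNP.Theorems.NoFBPPApproxAboveUniqueness
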